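import Literature.Geometry.Riemannian.PinchingEstimatesConstraints
import Mathlib.Algebra.Order.BigOperators.Ring.Finset
import HarnessLib

/-!
# Margerin's weak-pinching cone in Hamilton's block space (topic `Geometry/Riemannian`)

Margerin 1998, Part I, p. 25: "The trace-free curvature operator `𝒟 = … + W` is called the
deviation, and its (normalized) pointwise norm `|𝒟|² scal⁻²`, which is invariant under rescaling,
weak pinching" — in the `(0,4)`-normalisation of Chang–Gursky–Yang 2003, (0.2) (the tree's
`PseudoRiemannianMetric.weakPinching`) `WP = (|W|² + 2|E|²)/R²`; `S³ × ℝ` and `(ℂP², g_FS)` have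
`WP ≡ 1/6` (p. 21), Theorem 1 / Prop. 4 concern `R > 0`, `WP < 1/6`, and the heart of the proof
(Prop. 4, p. 27) is that "the fundamental polynomial `P₂(R)` is non-positive on `1/6`-weakly
pinched curvature tensors, and negative on any more pinched curvature", i.e. that the round cones
`{WP ≤ c}` are preserved by the reaction ODE of the curvature. This file places these cones in
**Hamilton's block space** `HamiltonODE.Blocks` (Hamilton 1986, §6: `M = (A B; ᵗB C)` on
`Λ²₊ ⊕ Λ²₋`), where Hamilton's ODE `HamiltonODE.field` and the maximum principle
`hamilton_maximumPrinciple_curvatureODE` live (as the Margerin leaf `hMargerin` of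
`changGurskyYang_sphere_four_of_margerin_of_pointwisePinching` requires):

* `frob X = Σᵢⱼ Xᵢⱼ²`; `tracelessMass (A, B, C) = ‖A − (tr A/3)1‖² + 2‖B‖² + ‖C − (tr C/3)1‖²`,
  which for the blocks of a Riemannian metric in an orthonormal frame is `Σ W² + 2 Σ E² = |𝒟|²`
  (`Σ W_{ijkl}² = ‖Å‖² + ‖C̊‖²` is the tree theorem `weylNormSqFrame_eq_hamiltonBlocks`;
  `Σ E_{ab}² = ‖B‖²` is the same bookkeeping for the mixed block, counted twice in `M`);
* `margerinCone k = {A, C symmetric, tr A = tr C ≥ 0, tracelessMass ≤ k (tr A)²}` — **the closed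
  round cone `WP ≤ k/4`** on the *Bianchi locus* (symmetry of `M` and the first Bianchi identity
  `tr A = tr C`, Hamilton 1986, p. 166; Chen–Zhu 2006, p. 4: "`tr A = tr C = ½R`"; for Levi-Civita
  blocks: `blockA_isSymm`, `blockC_isSymm`, `trace_blockA_eq_trace_blockC`,
  `trace_blockA_add_trace_blockC`) with `R = 2 tr A ≥ 0`, so `WP ≤ c ⟺ tracelessMass ≤ 4c (tr A)²`
  and `k = 4c`: `k = 2/3` is the critical `WP ≤ 1/6` (the blocks `(⅓·1, ±⅓·1, ⅓·1)` of `S³ × ℝ` —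
  either sign convention for `B`, the cone seeing only `‖B‖²` — and the Fubini–Study ray lie on its
  boundary), `k = 0` is the constant-curvature ray (`mem_margerinCone_zero_iff`).

PROVED here — everything `hamilton_maximumPrinciple_curvatureODE` asks of a family of sets except
ODE-invariance (Margerin's Prop. 4, NOT proved here): `isClosed_margerinCone`,
`isClosed_margerinCone_track`, `convex_margerinCone` (a second-order cone: Cauchy–Schwarz in the `36`
coordinates `coneCoord` in which `tracelessMass` is a plain sum of squares),
`reflectB_mem_margerinCone_iff`; the cone structure (`smul_mem_margerinCone`, `margerinCone_mono`,
`axis_mem_margerinCone`); and the bridge `mem_margerinCone_iff_scal` to the description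
`{|𝒟|² ≤ c R²}`, `R = tr A + tr C`, `|𝒟|² = ‖A‖² + 2‖B‖² + ‖C‖² − R²/6`, `c = k/4`.

## Design notes

* The typing (symmetric `A`, `C`, `tr A = tr C`, `tr A ≥ 0` inside the set) is load-bearing:
  Prop. 4 is a statement about curvature tensors, i.e. the Bianchi locus, and fails for general
  block triples (a skew part of `A` already breaks it); both linear constraints are forward-invariant
  under Hamilton's ODE (`HamiltonODE.isInvariant_isSymm`, `HamiltonODE.isInvariant_trace_eq`), as is
  `tr A ≥ 0` (`(tr A)' = (tr A)² + tr(BᵗB)`, `HamiltonODE.trace_field_fst`).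
* Norms are explicit polynomial sums (no norm instance on matrices is fixed, as in
  `HamiltonCurvatureODE.lean`), matching the right-hand side of `weylNormSqFrame_eq_hamiltonBlocks`.
* Not here: the fundamental polynomial `P_β` and its sign (Prop. 4, Parts II–V), the `β`-weak
  pinching sets `|𝒟|² ≤ K scal^β`, and the manifold-level dictionary `WP(x) ≤ c ⟺ blocks ∈
  margerinCone (4c)` (it needs `Σ E² = ‖B‖²`, not yet in the tree).

## References

* C. Margerin, *A sharp characterization of the smooth 4-sphere in curvature terms*, Comm. Anal.
  Geom. 6 (1998) 21–65: Part I, p. 25; Prop. 4 (p. 27); Prop. 28 (p. 58). [Margerin1998]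
* S.-Y. A. Chang, M. J. Gursky, P. C. Yang, Publ. Math. IHÉS 98 (2003), (0.2), Remark 2. [ChangGurskyYang2003]
* R. S. Hamilton, J. Differential Geom. 24 (1986) 153–179, §6, pp. 165–166. [Hamilton1986]
* B.-L. Chen, X.-P. Zhu, J. Differential Geom. 74 (2006), §2, p. 4. [ChenZhu2006]
-/

noncomputable section

open Set

namespace Literature.Geometry.Riemannian

namespace HamiltonODE

/-! ### Frobenius square norms of `3 × 3` blocks -/

/-- The **Frobenius square norm** `‖X‖² = Σᵢⱼ Xᵢⱼ²` of a `3 × 3` real block, as an explicit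
polynomial (the normalisation of the right-hand side of `weylNormSqFrame_eq_hamiltonBlocks`).
[folklore] -/
def frob (X : Matrix (Fin 3) (Fin 3) ℝ) : ℝ := ∑ i, ∑ j, X i j ^ 2

/-- `‖X‖² ≥ 0`. [folklore] -/
theorem frob_nonneg (X : Matrix (Fin 3) (Fin 3) ℝ) : 0 ≤ frob X :=
  Finset.sum_nonneg fun i _ ↦ Finset.sum_nonneg fun j _ ↦ sq_nonneg (X i j)

/-- `‖0‖² = 0`. [folklore] -/
@[simp] theorem frob_zero : frob 0 = 0 := by
  simp [frob]

/-- `‖-X‖² = ‖X‖²`. [folklore] -/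
@[simp] theorem frob_neg (X : Matrix (Fin 3) (Fin 3) ℝ) : frob (-X) = frob X := by
  simp [frob]

/-- `‖X‖² = 0` only for `X = 0`. [folklore] -/
theorem frob_eq_zero_iff (X : Matrix (Fin 3) (Fin 3) ℝ) : frob X = 0 ↔ X = 0 := by
  refine ⟨fun h ↦ ?_, fun h ↦ by rw [h, frob_zero]⟩
  ext i j
  have hi := (Finset.sum_eq_zero_iff_of_nonneg fun i _ ↦
    Finset.sum_nonneg fun j _ ↦ sq_nonneg (X i j)).1 h i (Finset.mem_univ i)
  have hij := (Finset.sum_eq_zero_iff_of_nonneg fun j _ ↦ sq_nonneg (X i j)).1 hi j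
    (Finset.mem_univ j)
  simpa using hij

/-- **The traceless part costs `(tr X)²/3`**: `‖X − (tr X/3)·1‖² = ‖X‖² − (tr X)²/3` for every
`3 × 3` real matrix (so `|𝒟|² = |Rm|² − R²/6` on the Bianchi locus, `tracelessMass_eq`).
[folklore] -/
theorem frob_sub_trace_smul_one (X : Matrix (Fin 3) (Fin 3) ℝ) :
    frob (X - (X.trace / 3) • (1 : Matrix (Fin 3) (Fin 3) ℝ)) = frob X - X.trace ^ 2 / 3 := by
  simp [frob, Matrix.trace, Fin.sum_univ_three, Matrix.one_apply]
  ring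

/-- `X ↦ ‖X‖²` is continuous. [folklore] -/
theorem continuous_frob : Continuous frob := by
  unfold frob
  exact continuous_finsetSum _ fun i _ ↦ continuous_finsetSum _ fun j _ ↦
    (continuous_id.matrix_elem i j).pow 2

/-! ### The traceless mass `‖Å‖² + 2‖B‖² + ‖C̊‖²` -/

/-- **Traceless Frobenius mass** `‖A − (tr A/3)1‖² + 2‖B‖² + ‖C − (tr C/3)1‖²` of a block triple
`(A, B, C)`: for the blocks of a Riemannian 4-metric in an orthonormal frame (`tr A = tr C = R/2`)
this is Margerin's `|𝒟|² = |W|² + 2|E|²` in the `(0,4)`-normalisation of Chang–Gursky–Yang 2003,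
(0.2) (`Σ W_{ijkl}² = ‖Å‖² + ‖C̊‖²`: `weylNormSqFrame_eq_hamiltonBlocks`; `Σ E_{ab}² = ‖B‖²`; the
mixed block is counted twice because `M` is a symmetric form on `Λ²₊ ⊕ Λ²₋`).
[cite: Margerin1998, Part I, p. 25] -/
def tracelessMass (p : Blocks) : ℝ :=
  frob (p.1 - (p.1.trace / 3) • (1 : Matrix (Fin 3) (Fin 3) ℝ)) + 2 * frob p.2.1 +
    frob (p.2.2 - (p.2.2.trace / 3) • (1 : Matrix (Fin 3) (Fin 3) ℝ))

/-- `|𝒟|² ≥ 0`. [folklore] -/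
theorem tracelessMass_nonneg (p : Blocks) : 0 ≤ tracelessMass p :=
  add_nonneg (add_nonneg (frob_nonneg _) (mul_nonneg zero_le_two (frob_nonneg _))) (frob_nonneg _)

/-- **`|𝒟|² = |Rm|² − (tr A)²/3 − (tr C)²/3`** (`= ‖A‖² + 2‖B‖² + ‖C‖² − R²/6` when
`tr A = tr C = R/2`): the traceless mass in terms of the full Frobenius masses. [folklore] -/
theorem tracelessMass_eq (p : Blocks) : tracelessMass p =
    frob p.1 + 2 * frob p.2.1 + frob p.2.2 - p.1.trace ^ 2 / 3 - p.2.2.trace ^ 2 / 3 := by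
  simp only [tracelessMass, frob_sub_trace_smul_one]
  ring

/-- The traceless mass is blind to the sign of `B` (`HamiltonODE.reflectB`). [folklore] -/
@[simp] theorem tracelessMass_reflectB (p : Blocks) :
    tracelessMass (reflectB p) = tracelessMass p := by
  simp [tracelessMass, reflectB]

/-- `p ↦ |𝒟|²(p)` is continuous. [folklore] -/
theorem continuous_tracelessMass : Continuous tracelessMass := by
  unfold tracelessMass
  have h1 : Continuous fun p : Blocks ↦ p.1 - (p.1.trace / 3) • (1 : Matrix (Fin 3) (Fin 3) ℝ) :=
    continuous_fst.sub ((continuous_fst.matrix_trace.div_const 3).smul continuous_const)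
  have h3 : Continuous fun p : Blocks ↦
      p.2.2 - (p.2.2.trace / 3) • (1 : Matrix (Fin 3) (Fin 3) ℝ) :=
    continuous_snd.snd.sub ((continuous_snd.snd.matrix_trace.div_const 3).smul continuous_const)
  exact ((continuous_frob.comp h1).add
    (continuous_const.mul (continuous_frob.comp continuous_snd.fst))).add (continuous_frob.comp h3)

/-- `|𝒟|² = 0` exactly on the axis data: `A = (tr A/3)·1`, `B = 0`, `C = (tr C/3)·1`. [folklore] -/
theorem tracelessMass_eq_zero_iff (p : Blocks) : tracelessMass p = 0 ↔
    p.1 = (p.1.trace / 3) • (1 : Matrix (Fin 3) (Fin 3) ℝ) ∧ p.2.1 = 0 ∧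
      p.2.2 = (p.2.2.trace / 3) • (1 : Matrix (Fin 3) (Fin 3) ℝ) := by
  constructor
  · intro h
    have hA := frob_nonneg (p.1 - (p.1.trace / 3) • (1 : Matrix (Fin 3) (Fin 3) ℝ))
    have hB := frob_nonneg p.2.1
    have hC := frob_nonneg (p.2.2 - (p.2.2.trace / 3) • (1 : Matrix (Fin 3) (Fin 3) ℝ))
    unfold tracelessMass at h
    exact ⟨sub_eq_zero.1 ((frob_eq_zero_iff _).1 (by linarith)),
      (frob_eq_zero_iff _).1 (by linarith), sub_eq_zero.1 ((frob_eq_zero_iff _).1 (by linarith))⟩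
  · rintro ⟨hA, hB, hC⟩
    unfold tracelessMass
    rw [sub_eq_zero.2 hA, hB, sub_eq_zero.2 hC, frob_zero]
    ring

/-! ### Margerin's cone -/

/-- **Margerin's closed weak-pinching cone `WP ≤ k/4` in Hamilton's block space** (Margerin 1998,
Part I, p. 25: weak pinching `WP = |𝒟|² scal⁻²`; Prop. 4, p. 27: the cones `WP ≤ c`, `c ≤ 1/6`,
along the Ricci flow): the block triples `(A, B, C)` with `A`, `C` symmetric and `tr A = tr C`
(the Bianchi locus of curvature operators of 4-manifolds, Hamilton 1986, §6), `tr A ≥ 0`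
(i.e. `R = tr A + tr C ≥ 0`), and `‖Å‖² + 2‖B‖² + ‖C̊‖² ≤ k (tr A)²`, i.e. `|𝒟|² ≤ (k/4) R²`.
The parameter is `k = 4c`: `k = 2/3` is Margerin's critical weak pinching `1/6` (`S³ × ℝ` and
`(ℂP², g_FS)` lie on the boundary of `margerinCone (2/3)`), `k = 0` is the constant-curvature ray
(`mem_margerinCone_zero_iff`). Closed (`isClosed_margerinCone`), convex (`convex_margerinCone`),
a cone (`smul_mem_margerinCone`), symmetric under `B ↦ -B` (`reflectB_mem_margerinCone_iff`).
[cite: Margerin1998, Part I, p. 25 and Prop. 4 (p. 27)] -/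
def margerinCone (k : ℝ) : Set Blocks :=
  {p | p.1.IsSymm ∧ p.2.2.IsSymm ∧ p.1.trace = p.2.2.trace ∧ 0 ≤ p.1.trace ∧
    tracelessMass p ≤ k * p.1.trace ^ 2}

/-- Unfolding lemma for membership in Margerin's cone. [folklore] -/
theorem mem_margerinCone_iff {k : ℝ} {p : Blocks} : p ∈ margerinCone k ↔
    p.1.IsSymm ∧ p.2.2.IsSymm ∧ p.1.trace = p.2.2.trace ∧ 0 ≤ p.1.trace ∧
      tracelessMass p ≤ k * p.1.trace ^ 2 :=
  Iff.rfl

/-- **The same cone in scalar-curvature form** (the typing `{|𝒟|² ≤ c R²}` with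
`R = tr A + tr C`, `|𝒟|² = ‖A‖² + 2‖B‖² + ‖C‖² − R²/6`, `c = k/4`): on the Bianchi locus the two
descriptions agree. [cite: Margerin1998, Part I, p. 25] -/
theorem mem_margerinCone_iff_scal {k : ℝ} {p : Blocks} : p ∈ margerinCone k ↔
    p.1.IsSymm ∧ p.2.2.IsSymm ∧ p.1.trace = p.2.2.trace ∧ 0 ≤ p.1.trace + p.2.2.trace ∧
      frob p.1 + 2 * frob p.2.1 + frob p.2.2 - (p.1.trace + p.2.2.trace) ^ 2 / 6 ≤
        k / 4 * (p.1.trace + p.2.2.trace) ^ 2 := by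
  rw [mem_margerinCone_iff, tracelessMass_eq]
  have h1 : (p.1.trace + p.1.trace) ^ 2 = 4 * p.1.trace ^ 2 := by ring
  refine ⟨fun ⟨hA, hC, htr, ht, hm⟩ ↦ ⟨hA, hC, htr, by linarith, ?_⟩,
    fun ⟨hA, hC, htr, ht, hm⟩ ↦ ⟨hA, hC, htr, by linarith, ?_⟩⟩ <;>
  · rw [← htr] at hm ⊢
    simp only [h1] at hm ⊢
    linarith

/-- A larger aperture gives a larger cone. [folklore] -/
theorem margerinCone_mono {k k' : ℝ} (h : k ≤ k') : margerinCone k ⊆ margerinCone k' :=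
  fun _ ⟨hA, hC, htr, ht, hm⟩ ↦
    ⟨hA, hC, htr, ht, hm.trans (mul_le_mul_of_nonneg_right h (sq_nonneg _))⟩

/-- **Symmetry under `B ↦ -B`** (the hypothesis of `hamilton_maximumPrinciple_curvatureODE` that
makes the sign of the `B^#` term immaterial). [folklore] -/
theorem reflectB_mem_margerinCone_iff {k : ℝ} {p : Blocks} :
    reflectB p ∈ margerinCone k ↔ p ∈ margerinCone k := by
  rw [mem_margerinCone_iff, mem_margerinCone_iff, tracelessMass_reflectB]
  rfl

/-- The origin (flat curvature) lies in every cone. [folklore] -/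
theorem zero_mem_margerinCone (k : ℝ) : (0 : Blocks) ∈ margerinCone k := by
  refine ⟨Matrix.isSymm_zero, Matrix.isSymm_zero, rfl, ?_, ?_⟩
  · simp
  · have h0 : tracelessMass 0 = 0 := (tracelessMass_eq_zero_iff 0).2 (by simp)
    simp [h0]

/-- **The constant-curvature ray lies in every cone** `margerinCone k`, `k ≥ 0`: the blocks
`((t/3)·1, 0, (t/3)·1)`, `t ≥ 0` (round `S⁴` of scalar curvature `R = 2t`), have `|𝒟|² = 0`.
[cite: Margerin1998, Part I, p. 25] -/
theorem axis_mem_margerinCone {k t : ℝ} (hk : 0 ≤ k) (ht : 0 ≤ t) :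
    ((t / 3) • (1 : Matrix (Fin 3) (Fin 3) ℝ), (0 : Matrix (Fin 3) (Fin 3) ℝ),
      (t / 3) • (1 : Matrix (Fin 3) (Fin 3) ℝ)) ∈ margerinCone k := by
  have htr : ((t / 3) • (1 : Matrix (Fin 3) (Fin 3) ℝ)).trace = t := by
    rw [Matrix.trace_smul, Matrix.trace_one, Fintype.card_fin, smul_eq_mul, Nat.cast_ofNat]
    ring
  have h0 : tracelessMass ((t / 3) • (1 : Matrix (Fin 3) (Fin 3) ℝ), (0 : Matrix (Fin 3) (Fin 3) ℝ),
      (t / 3) • (1 : Matrix (Fin 3) (Fin 3) ℝ)) = 0 :=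
    (tracelessMass_eq_zero_iff _).2 ⟨by simp [htr], rfl, by simp [htr]⟩
  refine ⟨(Matrix.isSymm_one).smul _, (Matrix.isSymm_one).smul _, rfl, ?_, ?_⟩
  · exact (show 0 ≤ t from ht).trans_eq htr.symm
  · show tracelessMass _ ≤ k * ((t / 3) • (1 : Matrix (Fin 3) (Fin 3) ℝ)).trace ^ 2
    rw [h0, htr]
    positivity

/-- **`k = 0` is the constant-curvature ray**: `margerinCone 0 = {((t/3)·1, 0, (t/3)·1) : t ≥ 0}`
(`|𝒟| = 0`, i.e. `W = 0` and `E = 0`). [cite: Margerin1998, Part I, p. 25] -/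
theorem mem_margerinCone_zero_iff {p : Blocks} : p ∈ margerinCone 0 ↔
    ∃ t : ℝ, 0 ≤ t ∧ p = ((t / 3) • (1 : Matrix (Fin 3) (Fin 3) ℝ),
      (0 : Matrix (Fin 3) (Fin 3) ℝ), (t / 3) • (1 : Matrix (Fin 3) (Fin 3) ℝ)) := by
  constructor
  · rintro ⟨-, -, htr, ht, hm⟩
    rw [zero_mul] at hm
    obtain ⟨h1, h2, h3⟩ :=
      (tracelessMass_eq_zero_iff p).1 (le_antisymm hm (tracelessMass_nonneg p))
    rw [← htr] at h3
    exact ⟨p.1.trace, ht, Prod.ext h1 (Prod.ext h2 h3)⟩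
  · rintro ⟨t, ht, rfl⟩
    exact axis_mem_margerinCone le_rfl ht

/-! ### Closedness -/

/-- **Margerin's cone is closed.** [folklore] -/
theorem isClosed_margerinCone (k : ℝ) : IsClosed (margerinCone k) := by
  have hS : margerinCone k = (({p : Blocks | p.1.IsSymm ∧ p.2.2.IsSymm} ∩
      {p : Blocks | p.1.trace = p.2.2.trace}) ∩ {p : Blocks | 0 ≤ p.1.trace}) ∩
        {p : Blocks | tracelessMass p ≤ k * p.1.trace ^ 2} := by
    ext p
    simp only [mem_margerinCone_iff, mem_inter_iff, mem_setOf_eq, and_assoc]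
  rw [hS]
  exact ((isClosed_isSymm.inter (isClosed_eq continuous_fst.matrix_trace
    continuous_snd.snd.matrix_trace)).inter (isClosed_le continuous_const
      continuous_fst.matrix_trace)).inter (isClosed_le continuous_tracelessMass
        (continuous_const.mul (continuous_fst.matrix_trace.pow 2)))

/-- The space-time track `{(t, p) : t ≥ 0, p ∈ margerinCone k}` of the constant family is closed
(the track hypothesis of `hamilton_maximumPrinciple_curvatureODE`). [folklore] -/
theorem isClosed_margerinCone_track (k : ℝ) :
    IsClosed {q : ℝ × Blocks | 0 ≤ q.1 ∧ q.2 ∈ margerinCone k} :=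
  isClosed_Ici.prod (isClosed_margerinCone k)

/-! ### Convexity: a second-order cone (Cauchy–Schwarz in `36` linear coordinates, then the chord
computation `|𝒟|²(a p + b q) = a²|𝒟|²(p) + 2ab⟨p, q⟩ + b²|𝒟|²(q) ≤ k (a·tr A(p) + b·tr A(q))²`) -/

/-- The `36` linear coordinates in which `tracelessMass` is a sum of squares: the entries of
`A − (tr A/3)1`, of `B` (twice) and of `C − (tr C/3)1`. [folklore] -/
def coneCoord (p : Blocks) :
    (Fin 3 × Fin 3) ⊕ (Fin 3 × Fin 3) ⊕ (Fin 3 × Fin 3) ⊕ (Fin 3 × Fin 3) → ℝ :=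
  Sum.elim (fun ij ↦ (p.1 - (p.1.trace / 3) • (1 : Matrix (Fin 3) (Fin 3) ℝ)) ij.1 ij.2) <|
    Sum.elim (fun ij ↦ p.2.1 ij.1 ij.2) <|
      Sum.elim (fun ij ↦ p.2.1 ij.1 ij.2)
        (fun ij ↦ (p.2.2 - (p.2.2.trace / 3) • (1 : Matrix (Fin 3) (Fin 3) ℝ)) ij.1 ij.2)

/-- The polar form `⟨p, q⟩ = Σₓ coneCoord p x · coneCoord q x` of `tracelessMass`. [folklore] -/
def coneInner (p q : Blocks) : ℝ := ∑ x, coneCoord p x * coneCoord q x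

/-- `|𝒟|²(p) = Σₓ (coneCoord p x)²`. [folklore] -/
theorem tracelessMass_eq_sum_sq (p : Blocks) : tracelessMass p = ∑ x, coneCoord p x ^ 2 := by
  simp only [coneCoord, Fintype.sum_sum_type, Sum.elim_inl, Sum.elim_inr, Fintype.sum_prod_type,
    tracelessMass, frob]
  ring

/-- The traceless part `X ↦ X − (tr X/3)1` is linear. [folklore] -/
theorem sub_trace_smul_one_combo (X Y : Matrix (Fin 3) (Fin 3) ℝ) (a b : ℝ) :
    a • X + b • Y - ((a • X + b • Y).trace / 3) • (1 : Matrix (Fin 3) (Fin 3) ℝ) =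
      a • (X - (X.trace / 3) • (1 : Matrix (Fin 3) (Fin 3) ℝ)) +
        b • (Y - (Y.trace / 3) • (1 : Matrix (Fin 3) (Fin 3) ℝ)) := by
  ext i j
  simp only [Matrix.trace_add, Matrix.trace_smul, smul_eq_mul, Matrix.sub_apply, Matrix.add_apply,
    Matrix.smul_apply, Matrix.one_apply]
  split_ifs <;> ring

/-- The coordinates are linear in the block triple. [folklore] -/
theorem coneCoord_combo (p q : Blocks) (a b : ℝ) :
    coneCoord (a • p + b • q) = fun x ↦ a * coneCoord p x + b * coneCoord q x := by
  ext x
  rcases x with ij | ij | ij | ij <;>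
    simp only [coneCoord, Sum.elim_inl, Sum.elim_inr, Prod.fst_add, Prod.snd_add, Prod.smul_fst,
      Prod.smul_snd, sub_trace_smul_one_combo, Matrix.add_apply, Matrix.smul_apply, smul_eq_mul]

/-- **Chord expansion**: `|𝒟|²(a p + b q) = a²|𝒟|²(p) + 2ab⟨p, q⟩ + b²|𝒟|²(q)`. [folklore] -/
theorem tracelessMass_combo (p q : Blocks) (a b : ℝ) :
    tracelessMass (a • p + b • q) =
      a ^ 2 * tracelessMass p + 2 * a * b * coneInner p q + b ^ 2 * tracelessMass q := by
  simp only [tracelessMass_eq_sum_sq, coneInner, coneCoord_combo, Finset.mul_sum,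
    ← Finset.sum_add_distrib]
  exact Finset.sum_congr rfl fun x _ ↦ by ring

/-- `|𝒟|²` is homogeneous of degree two. [folklore] -/
theorem tracelessMass_smul (c : ℝ) (p : Blocks) : tracelessMass (c • p) = c ^ 2 * tracelessMass p := by
  simpa using tracelessMass_combo p 0 c 0

/-- **Cauchy–Schwarz** for the polar form: `⟨p, q⟩² ≤ |𝒟|²(p) · |𝒟|²(q)`. [folklore] -/
theorem coneInner_sq_le (p q : Blocks) : coneInner p q ^ 2 ≤ tracelessMass p * tracelessMass q := by
  rw [tracelessMass_eq_sum_sq, tracelessMass_eq_sum_sq]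
  exact Finset.sum_mul_sq_le_sq_mul_sq _ _ _

/-- Inside the cone the polar form is controlled by the traces: `⟨p, q⟩ ≤ k · tr A(p) · tr A(q)`.
[folklore] -/
theorem coneInner_le {k : ℝ} {p q : Blocks} (hk : 0 ≤ k) (hp0 : 0 ≤ p.1.trace)
    (hq0 : 0 ≤ q.1.trace) (hp : tracelessMass p ≤ k * p.1.trace ^ 2)
    (hq : tracelessMass q ≤ k * q.1.trace ^ 2) :
    coneInner p q ≤ k * p.1.trace * q.1.trace := by
  have h1 : coneInner p q ^ 2 ≤ (k * p.1.trace * q.1.trace) ^ 2 :=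
    calc coneInner p q ^ 2 ≤ tracelessMass p * tracelessMass q := coneInner_sq_le p q
      _ ≤ (k * p.1.trace ^ 2) * (k * q.1.trace ^ 2) :=
          mul_le_mul hp hq (tracelessMass_nonneg q) (by positivity)
      _ = (k * p.1.trace * q.1.trace) ^ 2 := by ring
  exact (le_abs_self _).trans (abs_le_of_sq_le_sq h1 (by positivity))

/-- **Margerin's cone is a cone**: invariant under scaling by `c ≥ 0`. [folklore] -/
theorem smul_mem_margerinCone {k c : ℝ} {p : Blocks} (hc : 0 ≤ c) (hp : p ∈ margerinCone k) :
    c • p ∈ margerinCone k := by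
  obtain ⟨hA, hC, htr, ht, hm⟩ := hp
  refine ⟨hA.smul c, hC.smul c, ?_, ?_, ?_⟩
  · show (c • p.1).trace = (c • p.2.2).trace
    rw [Matrix.trace_smul, Matrix.trace_smul, htr]
  · show 0 ≤ (c • p.1).trace
    rw [Matrix.trace_smul, smul_eq_mul]
    exact mul_nonneg hc ht
  · show tracelessMass (c • p) ≤ k * (c • p.1).trace ^ 2
    rw [tracelessMass_smul, Matrix.trace_smul, smul_eq_mul]
    calc c ^ 2 * tracelessMass p ≤ c ^ 2 * (k * p.1.trace ^ 2) :=
        mul_le_mul_of_nonneg_left hm (sq_nonneg c)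
      _ = k * (c * p.1.trace) ^ 2 := by ring

/-- **Margerin's cone is convex** (`k ≥ 0`): a second-order cone over the Bianchi locus.
[folklore] -/
theorem convex_margerinCone {k : ℝ} (hk : 0 ≤ k) : Convex ℝ (margerinCone k) := by
  intro p hp q hq a b ha hb hab
  obtain ⟨hpA, hpC, hptr, hpt, hpm⟩ := hp
  obtain ⟨hqA, hqC, hqtr, hqt, hqm⟩ := hq
  have hsymm := isSymm_combo ⟨hpA, hpC⟩ ⟨hqA, hqC⟩ a b
  have htA : (a • p + b • q).1.trace = a * p.1.trace + b * q.1.trace := by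
    show (a • p.1 + b • q.1).trace = _
    rw [Matrix.trace_add, Matrix.trace_smul, Matrix.trace_smul, smul_eq_mul, smul_eq_mul]
  have htC : (a • p + b • q).2.2.trace = a * p.2.2.trace + b * q.2.2.trace := by
    show (a • p.2.2 + b • q.2.2).trace = _
    rw [Matrix.trace_add, Matrix.trace_smul, Matrix.trace_smul, smul_eq_mul, smul_eq_mul]
  refine ⟨hsymm.1, hsymm.2, ?_, ?_, ?_⟩
  · rw [htA, htC, hptr, hqtr]
  · rw [htA]
    exact add_nonneg (mul_nonneg ha hpt) (mul_nonneg hb hqt)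
  · rw [htA, tracelessMass_combo]
    have h1 : a ^ 2 * tracelessMass p ≤ a ^ 2 * (k * p.1.trace ^ 2) :=
      mul_le_mul_of_nonneg_left hpm (sq_nonneg a)
    have h2 : b ^ 2 * tracelessMass q ≤ b ^ 2 * (k * q.1.trace ^ 2) :=
      mul_le_mul_of_nonneg_left hqm (sq_nonneg b)
    have h3 : 2 * a * b * coneInner p q ≤ 2 * a * b * (k * p.1.trace * q.1.trace) :=
      mul_le_mul_of_nonneg_left (coneInner_le hk hpt hqt hpm hqm) (by positivity)
    have h4 : k * (a * p.1.trace + b * q.1.trace) ^ 2 = a ^ 2 * (k * p.1.trace ^ 2) +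
        2 * a * b * (k * p.1.trace * q.1.trace) + b ^ 2 * (k * q.1.trace ^ 2) := by ring
    rw [h4]
    exact add_le_add (add_le_add h1 h3) h2

end HamiltonODE

end Literature.Geometry.Riemannian

end
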